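import Literature.Analysis.Complex.EvenHolomorphicDivision
import Literature.Analysis.Complex.WeierstrassPreparation
import HarnessLib

/-!
# A symmetric double root: the pair of roots `±ρ(z)` and the critical value function

Local complex analysis in several variables (E. M. Chirka, *Complex Analytic Sets* (1989), §1.1: Weierstrass data and
holomorphy of symmetric functions of the roots; §2.8: division).  Written by the prover seat `hodge-nonav-prover-Bx`
(g12, cell `hodge-nonav`) for the bifurcation analysis of the symmetric `A₃` point (programme B2-BIF,
`Literature/AlgebraicGeometry/HodgeTheory/SymmetricA3*`): there the reduced `∂_u`-partial `s(μ, u)` of the unfolding is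
EVEN in the kernel coordinate `u` with a double root at the origin, and the reduced value function `φ(μ, u)` is even
with `∂_u φ = u · s`.

Setting: `s : E × ℂ → ℂ` with `WeierstrassData s V 0 r R` (`V` open preconnected, `0 ∈ V`), `s` even in `u`, the slice
`s(0, ·)` having the double root `{0, 0}` in `|u| < r`.

* `SCV.sliceRoots_eq_pair_of_even` — for every `z ∈ V` the roots of `s(z, ·)` in `|u| < r` are a symmetric pair
  `{ρ, −ρ}`;
* `SCV.rootSum_eq_two_mul_of_even` — hence the root sum of an even `g` is `2 g(z, ρ)` at either root;
* `SCV.exists_evenCriticalValue` — for `φ` holomorphic and even in `u` with `∂_u φ = u · s`: the CRITICAL VALUE FUNCTION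
  `G(z) = φ(z, ±ρ(z))` is holomorphic on `V`, `G(0) = φ(0)`, and if `s(0) = 0` then `dG(0) = d(φ(·, 0))(0)` (the
  root pair does not contribute to first order); moreover `G(z) = φ(z, 0) + ½ e(z) Q(z)` with `e(z) = Σ ρ²` and `Q`
  holomorphic, `e(0) = 0`, where `φ(z, u) = φ(z, 0) + u² q(z, u)`, `Q(z) = q(z, ±ρ(z))`, `s = 2q + u ∂_u q`
  (the data used to show `G ≠ φ(·, 0)` off the origin in the `A₃` analysis).

## References
* [Chirka1989] E. M. Chirka, *Complex Analytic Sets*, Kluwer 1989, §1.1 (pp. 3–4), §2.8.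
* [ArnoldGuseinzadeVarchenko2012] AGZV II, Part I §5.2 (the level bifurcation set of `B₂`).
-/

noncomputable section

open Metric Set Filter
open scoped Topology

namespace Literature.Analysis.Complex
namespace SCV

variable {E : Type*} [NormedAddCommGroup E] [NormedSpace ℂ E]

/-- **The roots of an even slice with two roots form a symmetric pair.**  Let `WeierstrassData s V 0 r R` with `V`
preconnected, `s` even in `u`, and two roots (with multiplicity) over some `z₀ ∈ V`.  Then over every `z ∈ V` the
root multiset is `{ρ, −ρ}` for each of its members `ρ`. [cite: Chirka1989, §1.1] -/
theorem sliceRoots_eq_pair_of_even {s : E × ℂ → ℂ} {V : Set E} {r R : ℝ} (hW : WeierstrassData s V 0 r R)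
    (hVc : IsPreconnected V) {z₀ : E} (hz₀ : z₀ ∈ V) (h2 : Multiset.card (sliceRoots s 0 r z₀) = 2)
    (hseven : ∀ p ∈ V ×ˢ ball (0 : ℂ) R, s (p.1, -p.2) = s p) {z : E} (hz : z ∈ V) {ρ : ℂ}
    (hρ : ρ ∈ sliceRoots s 0 r z) : sliceRoots s 0 r z = {ρ, -ρ} := by
  classical
  have hcard : Multiset.card (sliceRoots s 0 r z) = 2 := by rw [hW.card_sliceRoots_eq hVc hz₀ hz, h2]
  -- membership in the root multiset
  have hmem : ∀ w : ℂ, w ∈ sliceRoots s 0 r z ↔ w ∈ ball (0 : ℂ) r ∧ s (z, w) = 0 := fun w =>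
    mem_rootMultiset_iff (hW.differentiableOn_slice hz) hW.pos hW.lt (hW.ne_zero z hz)
  have hneg : ∀ w : ℂ, w ∈ sliceRoots s 0 r z → -w ∈ sliceRoots s 0 r z := by
    intro w hw
    obtain ⟨hwb, hws⟩ := (hmem w).1 hw
    refine (hmem (-w)).2 ⟨by simpa using hwb, ?_⟩
    have := hseven (z, w) ⟨hz, hW.sphere_subset.trans (fun _ h => h) |> fun _ => ball_subset_ball hW.lt.le hwb⟩
    simpa using this.trans hws
  -- split off `ρ`
  obtain ⟨M, hM⟩ := Multiset.exists_cons_of_mem hρ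
  have hM1 : Multiset.card M = 1 := by
    have := hcard; rw [hM, Multiset.card_cons] at this; omega
  obtain ⟨ρ', hρ'⟩ := Multiset.card_eq_one.1 hM1
  rw [hρ'] at hM
  -- `hM : sliceRoots = ρ ::ₘ {ρ'}`; show `ρ' = -ρ`
  rw [hM]
  have hnegρ : -ρ ∈ (ρ ::ₘ ({ρ'} : Multiset ℂ)) := hM ▸ hneg ρ hρ
  rw [Multiset.mem_cons, Multiset.mem_singleton] at hnegρ
  rcases hnegρ with h | h
  · -- `-ρ = ρ`, so `ρ = 0`; then `ρ'` must be `0` too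
    have hρ0 : ρ = 0 := by
      have h2 : (2 : ℂ) * ρ = 0 := by linear_combination -h
      exact (mul_eq_zero.1 h2).resolve_left two_ne_zero
    have hρ'mem : ρ' ∈ sliceRoots s 0 r z := by rw [hM]; simp
    have hnegρ' : -ρ' ∈ (ρ ::ₘ ({ρ'} : Multiset ℂ)) := hM ▸ hneg ρ' hρ'mem
    rw [Multiset.mem_cons, Multiset.mem_singleton] at hnegρ'
    have hρ'0 : ρ' = 0 := by
      rcases hnegρ' with h' | h'
      · rw [hρ0] at h'; exact neg_eq_zero.1 h'
      · have h2 : (2 : ℂ) * ρ' = 0 := by linear_combination -h'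
        exact (mul_eq_zero.1 h2).resolve_left two_ne_zero
    rw [hρ0, hρ'0, neg_zero]
    exact (Multiset.insert_eq_cons _ _).symm
  · rw [h]
    exact (Multiset.insert_eq_cons _ _).symm

/-- **Root sums of even functions over a symmetric pair**: `Σ_{roots} g(z, ρ) = 2 g(z, ρ₀)` for any root `ρ₀`, when
`g` is even in `u`. [cite: Chirka1989, §1.1] -/
theorem rootSum_eq_two_mul_of_even {s : E × ℂ → ℂ} {V : Set E} {r R : ℝ} (hW : WeierstrassData s V 0 r R)
    (hVc : IsPreconnected V) {z₀ : E} (hz₀ : z₀ ∈ V) (h2 : Multiset.card (sliceRoots s 0 r z₀) = 2)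
    (hseven : ∀ p ∈ V ×ˢ ball (0 : ℂ) R, s (p.1, -p.2) = s p) {g : E × ℂ → ℂ}
    (hgeven : ∀ p ∈ V ×ˢ ball (0 : ℂ) R, g (p.1, -p.2) = g p) {z : E} (hz : z ∈ V) {ρ : ℂ}
    (hρ : ρ ∈ sliceRoots s 0 r z) : ((sliceRoots s 0 r z).map fun w => g (z, w)).sum = 2 * g (z, ρ) := by
  rw [sliceRoots_eq_pair_of_even hW hVc hz₀ h2 hseven hz hρ]
  have hρb : ρ ∈ ball (0 : ℂ) R := ball_subset_ball hW.lt.le (mem_ball_of_mem_rootMultiset hρ)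
  have := hgeven (z, ρ) ⟨hz, hρb⟩
  simp only [Multiset.insert_eq_cons, Multiset.map_cons, Multiset.map_singleton, Multiset.sum_cons,
    Multiset.sum_singleton]
  change g (z, ρ) + g (z, -ρ) = 2 * g (z, ρ)
  rw [this]; ring

/-- **The critical value function of an even unfolding with a symmetric double root.**  Let
`WeierstrassData s V 0 r R` (`V` open, preconnected, `0 ∈ V`, `E` finite-dimensional), `s` even in `u` with
`sliceRoots s 0 r 0 = {0, 0}` and `s(0) = 0`, and let `φ` be holomorphic on `V × {|u| < R}`, even in `u`, with
`∂_u φ = u · s`.  Then there are `G, e, Q : V → ℂ` and `q : V × {|u| < R} → ℂ`, holomorphic, with: for every `z ∈ V`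
and every root `ρ` of `s(z, ·)` in `|u| < r`, `G(z) = φ(z, ρ)` and `Q(z) = q(z, ρ)`, and such a root exists with
`sliceRoots = {ρ, −ρ}`, `|ρ| < r`, `s(z, ρ) = 0`; `φ(z, u) = φ(z, 0) + u² q(z, u)`, `q` even,
`s = 2 q + u ∂_u q`; `e(z) = Σ_{roots} ρ²`, `e(0) = 0`, `q(0) = 0`; `G(z) = φ(z, 0) + ½ e(z) Q(z)`; `G(0) = φ(0)`;
and `dG(0) = d(φ(·, 0))(0)`. [cite: Chirka1989, §1.1] [cite: ArnoldGuseinzadeVarchenko2012, Part I §5.2] -/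
theorem exists_evenCriticalValue [FiniteDimensional ℂ E] {s φ : E × ℂ → ℂ} {V : Set E} {r R : ℝ}
    (hV : IsOpen V) (hVc : IsPreconnected V) (h0V : (0 : E) ∈ V) (hW : WeierstrassData s V 0 r R)
    (h2 : sliceRoots s 0 r 0 = Multiset.replicate 2 0)
    (hseven : ∀ p ∈ V ×ˢ ball (0 : ℂ) R, s (p.1, -p.2) = s p) (hs0 : s 0 = 0)
    (hφ : DifferentiableOn ℂ φ (V ×ˢ ball (0 : ℂ) R))
    (hφeven : ∀ p ∈ V ×ˢ ball (0 : ℂ) R, φ (p.1, -p.2) = φ p)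
    (hφu : ∀ p ∈ V ×ˢ ball (0 : ℂ) R, fderiv ℂ φ p (0, 1) = p.2 * s p) :
    ∃ (G e Q : E → ℂ) (q : E × ℂ → ℂ),
      DifferentiableOn ℂ G V ∧ DifferentiableOn ℂ e V ∧ DifferentiableOn ℂ Q V ∧
      DifferentiableOn ℂ q (V ×ˢ ball (0 : ℂ) R) ∧
      (∀ z ∈ V, ∃ ρ : ℂ, sliceRoots s 0 r z = {ρ, -ρ} ∧ ρ ∈ ball (0 : ℂ) r ∧ s (z, ρ) = 0) ∧
      (∀ z ∈ V, ∀ ρ ∈ sliceRoots s 0 r z, G z = φ (z, ρ) ∧ Q z = q (z, ρ) ∧ e z = 2 * ρ ^ 2) ∧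
      (∀ p ∈ V ×ˢ ball (0 : ℂ) R, φ p = φ (p.1, 0) + p.2 ^ 2 * q p) ∧
      (∀ p ∈ V ×ˢ ball (0 : ℂ) R, q (p.1, -p.2) = q p) ∧
      (∀ p ∈ V ×ˢ ball (0 : ℂ) R, s p = 2 * q p + p.2 * fderiv ℂ q p (0, 1)) ∧
      e 0 = 0 ∧ q 0 = 0 ∧
      (∀ z ∈ V, G z = φ (z, 0) + (1 / 2 : ℂ) * e z * Q z) ∧
      G 0 = φ 0 ∧
      HasFDerivAt G (fderiv ℂ (fun z : E => φ (z, 0)) 0) 0 := by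
  classical
  have hU : IsOpen (V ×ˢ ball (0 : ℂ) R) := hV.prod isOpen_ball
  have hR : 0 < R := hW.pos.trans hW.lt
  have hmem0 : ∀ z ∈ V, ((z, (0 : ℂ)) : E × ℂ) ∈ V ×ˢ ball (0 : ℂ) R := fun z hz => ⟨hz, mem_ball_self hR⟩
  have hcard0 : Multiset.card (sliceRoots s 0 r 0) = 2 := by rw [h2, Multiset.card_replicate]
  -- roots: membership, pairs
  have hmem : ∀ z ∈ V, ∀ w : ℂ, w ∈ sliceRoots s 0 r z ↔ w ∈ ball (0 : ℂ) r ∧ s (z, w) = 0 := fun z hz w =>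
    mem_rootMultiset_iff (hW.differentiableOn_slice hz) hW.pos hW.lt (hW.ne_zero z hz)
  have hpair : ∀ z ∈ V, ∃ ρ : ℂ, sliceRoots s 0 r z = {ρ, -ρ} ∧ ρ ∈ ball (0 : ℂ) r ∧ s (z, ρ) = 0 := by
    intro z hz
    have hc : Multiset.card (sliceRoots s 0 r z) = 2 := by rw [hW.card_sliceRoots_eq hVc h0V hz, hcard0]
    obtain ⟨ρ, hρ⟩ := Multiset.card_pos_iff_exists_mem.1 (by rw [hc]; norm_num)
    exact ⟨ρ, sliceRoots_eq_pair_of_even hW hVc h0V hcard0 hseven hz hρ, (hmem z hz ρ).1 hρ⟩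
  -- the division `φ = φ(·, 0) + u² q`
  have hφ0d : DifferentiableOn ℂ (fun p : E × ℂ => φ (p.1, 0)) (V ×ˢ ball (0 : ℂ) R) :=
    hφ.comp (by fun_prop) fun p hp => hmem0 p.1 hp.1
  obtain ⟨q, hqd, hq, hqeven⟩ := exists_sq_mul_of_even hV (f := fun p => φ p - φ (p.1, 0)) (hφ.sub hφ0d)
    (fun p hp => by change φ (p.1, -p.2) - φ (p.1, 0) = φ p - φ (p.1, 0); rw [hφeven p hp])
    (fun p hp hp0 => by rw [show p = (p.1, 0) from Prod.ext rfl hp0]; exact sub_self _)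
  have hq' : ∀ p ∈ V ×ˢ ball (0 : ℂ) R, φ p = φ (p.1, 0) + p.2 ^ 2 * q p := fun p hp => by
    have := hq p hp; change φ p - φ (p.1, 0) = _ at this; linear_combination this
  -- `s = 2 q + u ∂_u q`
  have hfu : ∀ p ∈ V ×ˢ ball (0 : ℂ) R, fderiv ℂ (fun p : E × ℂ => φ p - φ (p.1, 0)) p (0, 1) = p.2 * s p := by
    intro p hp
    have h1 : HasFDerivAt φ (fderiv ℂ φ p) p := (hφ.differentiableAt (hU.mem_nhds hp)).hasFDerivAt
    have h2 : HasFDerivAt (fun p : E × ℂ => φ (p.1, 0))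
        ((fderiv ℂ φ (p.1, 0)).comp ((ContinuousLinearMap.fst ℂ E ℂ).prod 0)) p := by
      have hi : HasFDerivAt (fun p : E × ℂ => ((p.1, (0 : ℂ)) : E × ℂ)) ((ContinuousLinearMap.fst ℂ E ℂ).prod 0) p :=
        (ContinuousLinearMap.fst ℂ E ℂ).hasFDerivAt.prodMk (hasFDerivAt_const (0 : ℂ) p)
      have hφ' : HasFDerivAt φ (fderiv ℂ φ (p.1, 0)) (p.1, 0) :=
        (hφ.differentiableAt (hU.mem_nhds (hmem0 p.1 hp.1))).hasFDerivAt
      exact hφ'.comp p hi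
    rw [(h1.fun_sub h2).fderiv]
    have hsnd : ((ContinuousLinearMap.fst ℂ E ℂ).prod (0 : E × ℂ →L[ℂ] ℂ)) ((0 : E), (1 : ℂ)) = 0 := by
      ext <;> simp
    rw [sub_apply, ContinuousLinearMap.comp_apply, hsnd, map_zero, sub_zero]
    exact hφu p hp
  have hs_eq : ∀ p ∈ V ×ˢ ball (0 : ℂ) R, s p = 2 * q p + p.2 * fderiv ℂ q p (0, 1) :=
    eq_two_mul_add_of_sq_mul hV hqd hW.differentiableOn.continuousOn hq hfu
  have h00 : ((0 : E × ℂ)) ∈ V ×ˢ ball (0 : ℂ) R := ⟨h0V, mem_ball_self hR⟩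
  have hq0 : q 0 = 0 := by
    have := hs_eq 0 h00
    rw [hs0] at this
    have h' : (2 : ℂ) * q 0 = 0 := by
      have hz : ((0 : E × ℂ)).2 = 0 := rfl
      rw [hz, zero_mul, add_zero] at this
      exact this.symm
    exact (mul_eq_zero.1 h').resolve_left two_ne_zero
  -- the symmetric functions of the roots
  obtain ⟨G, hG⟩ : ∃ G : E → ℂ, ∀ z, G z = (1 / 2 : ℂ) * ((sliceRoots s 0 r z).map fun w => φ (z, w)).sum :=
    ⟨_, fun _ => rfl⟩
  obtain ⟨e, he⟩ : ∃ e : E → ℂ, ∀ z, e z = ((sliceRoots s 0 r z).map fun w => w ^ 2).sum := ⟨_, fun _ => rfl⟩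
  obtain ⟨Q, hQ⟩ : ∃ Q : E → ℂ, ∀ z, Q z = (1 / 2 : ℂ) * ((sliceRoots s 0 r z).map fun w => q (z, w)).sum :=
    ⟨_, fun _ => rfl⟩
  have hGd : DifferentiableOn ℂ G V := by
    have : G = fun z => (1 / 2 : ℂ) * ((sliceRoots s 0 r z).map fun w => φ (z, w)).sum := funext hG
    rw [this]
    exact (hW.differentiableOn_rootSum hφ).const_mul _
  have hed : DifferentiableOn ℂ e V := by
    have : e = fun z => ((sliceRoots s 0 r z).map fun w => (fun p : E × ℂ => p.2 ^ 2) (z, w)).sum := funext he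
    rw [this]
    exact hW.differentiableOn_rootSum (differentiableOn_snd.pow 2)
  have hQd : DifferentiableOn ℂ Q V := by
    have : Q = fun z => (1 / 2 : ℂ) * ((sliceRoots s 0 r z).map fun w => q (z, w)).sum := funext hQ
    rw [this]
    exact (hW.differentiableOn_rootSum hqd).const_mul _
  -- values at the roots
  have hroot : ∀ z ∈ V, ∀ ρ ∈ sliceRoots s 0 r z, G z = φ (z, ρ) ∧ Q z = q (z, ρ) ∧ e z = 2 * ρ ^ 2 := by
    intro z hz ρ hρ
    refine ⟨?_, ?_, ?_⟩
    · rw [hG, rootSum_eq_two_mul_of_even hW hVc h0V hcard0 hseven hφeven hz hρ]; ring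
    · rw [hQ, rootSum_eq_two_mul_of_even hW hVc h0V hcard0 hseven hqeven hz hρ]; ring
    · rw [he, rootSum_eq_two_mul_of_even hW hVc h0V hcard0 hseven (g := fun p : E × ℂ => p.2 ^ 2)
        (fun p _ => by simp) hz hρ]
  have he0 : e 0 = 0 := by rw [he, h2]; simp
  have hG0 : G 0 = φ 0 := by
    rw [hG, h2]
    simp only [Multiset.map_replicate, Multiset.sum_replicate]
    rw [nsmul_eq_mul]; ring_nf; rfl
  -- the decomposition `G = φ(·, 0) + ½ e Q`
  have hdec : ∀ z ∈ V, G z = φ (z, 0) + (1 / 2 : ℂ) * e z * Q z := by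
    intro z hz
    obtain ⟨ρ, hρeq, hρb, -⟩ := hpair z hz
    have hρ : ρ ∈ sliceRoots s 0 r z := by rw [hρeq]; simp
    obtain ⟨h1, h2', h3⟩ := hroot z hz ρ hρ
    have hzρ : ((z, ρ) : E × ℂ) ∈ V ×ˢ ball (0 : ℂ) R := ⟨hz, ball_subset_ball hW.lt.le hρb⟩
    have h4 := hq' (z, ρ) hzρ
    rw [h1, h4, h3, h2']
    ring
  -- the derivative at `0`
  have hφV : DifferentiableOn ℂ (fun z : E => φ (z, 0)) V :=
    hφ.comp (differentiableOn_id.prodMk (differentiableOn_const _)) fun z hz => hmem0 z hz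
  have hA : HasFDerivAt (fun z : E => φ (z, 0)) (fderiv ℂ (fun z : E => φ (z, 0)) 0) 0 :=
    (hφV.differentiableAt (hV.mem_nhds h0V)).hasFDerivAt
  have hQ0 : Q 0 = 0 := by
    have hρ : (0 : ℂ) ∈ sliceRoots s 0 r 0 := by rw [h2]; simp
    rw [(hroot 0 h0V 0 hρ).2.1]
    exact hq0
  have hB : HasFDerivAt (fun z : E => (1 / 2 : ℂ) * e z * Q z) (0 : E →L[ℂ] ℂ) 0 := by
    have h1 : HasFDerivAt e (fderiv ℂ e 0) 0 := (hed.differentiableAt (hV.mem_nhds h0V)).hasFDerivAt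
    have h2' : HasFDerivAt Q (fderiv ℂ Q 0) 0 := (hQd.differentiableAt (hV.mem_nhds h0V)).hasFDerivAt
    have h3 := (h1.const_mul (1 / 2 : ℂ)).fun_mul h2'
    refine h3.congr_fderiv ?_
    rw [he0, hQ0, mul_zero]
    ext v
    simp [add_apply, smul_apply]
  have hsum := hA.fun_add hB
  rw [add_zero] at hsum
  have hGd0 : HasFDerivAt G (fderiv ℂ (fun z : E => φ (z, 0)) 0) 0 := by
    refine hsum.congr_of_eventuallyEq ?_
    filter_upwards [hV.mem_nhds h0V] with z hz
    exact hdec z hz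
  exact ⟨G, e, Q, q, hGd, hed, hQd, hqd, hpair, hroot, hq', hqeven, hs_eq, he0, hq0, hdec, hG0, hGd0⟩

end SCV
end Literature.Analysis.Complex

end
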